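import Summits.HodgeConjecture.CorCM.MumfordTateRankCMThreefoldTimesCMCurvesTower
import Summits.HodgeConjecture.CorCM.MumfordTateRankTypeIVThreefoldTimesAllCurves
import Summits.HodgeConjecture.CorCM.MumfordTateRankThreefoldTimesCurves
import Summits.HodgeConjecture.CorCM.MumfordTateRankCMThreefoldTimesCurves
import HarnessLib

/-!
# A simple CM abelian THREEFOLD times ANY elliptic curves: `t(T × ⨁E) + 1 + δ = t(T) + t(⨁E)`, `δ = 1` iff some CM curve has its field inside `End⁰T`;
# hence EVERY simple abelian threefold times any elliptic curves is decided (Moonen–Zarhin 1999 Thm. (0.2), §3 (3.4), (3.8))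

COR-CM (cell `pub-hodgecm2`, seat `b27` gen 51, count-neutral Mumford–Tate-rank ladder; theorems only, no definition, no named fact;
UNCONDITIONAL — nothing here uses or asserts HC_CM).  Notation `t(X) = dim MT(H¹X)`; `T` a simple abelian threefold; for `T` of CM type `t(T) = 4`.

The CM-threefold companion of `CorCM/MumfordTateRankTypeIVThreefoldTimesAnyCurves` / `…AllCurves` (type IV(2,1)): the CM part is
`CorCM/MumfordTateRankCMThreefoldTimesCMCurvesTower` (`t(T × ⨁E_C) = #C + 4 − δ`), the non-CM curves add `3` each (Lemma (3.4) over the base `T × ⨁E_C`),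
repetitions are removed on the isogeny-class map (`exists_representatives_mtRank_eq_of_curves`).
* §1 pairwise non-isogenous curves: **`mtRank_hodge_one_add_one_eq_of_isIsogenous_cmThreefold_prod_biproduct_curves_of_isEmpty`** (`t + 1 = 4 + t(⨁E)`),
  **`…add_two_eq…_of_nonempty`** (`t + 2 = 4 + t(⨁E)`); cells `3a + b + 4` / `3a + b + 3`.
* §2 ANY curves (repetitions): **`…anyCurves_of_isEmpty`**, **`…anyCurves_of_nonempty`**; cells with `a`, `b` the numbers of isogeny classes.
* §3 **EVERY SIMPLE ABELIAN THREEFOLD × ANY ELLIPTIC CURVES**: `mtRank_hodge_one_add_one_eq_of_isIsogenous_isSimple_threefold_prod_biproduct_anyCurves_of_isEmpty`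
  — `t(T × ⨁E) + 1 = t(T) + t(⨁E)` whenever no CM curve has its field inside `End⁰T` (automatic for `End⁰T` totally real: gen 49
  `CorCM/MumfordTateRankThreefoldTimesCurves`, `CorCM/MumfordTateRankTimesLowGeneric`, `…TimesRealMultiplicationCells`); and `+ 2` when some CM curve
  has `End⁰E_j ↪ End⁰T` (`dim_ℚ End⁰T ∈ {2, 6}`).

## References
* [MoonenZarhin1999LowDim] B. Moonen, Yu. G. Zarhin, *Hodge classes on abelian varieties of low dimension*, Math. Ann. 315 (1999), Thm. (0.2), §2 (2.3), §3 (3.1),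
  Lemma (3.4), Prop. (3.8), §5 (5.2) [corpus: paper:arxiv-math_9901113 pp. 1–2, 5–7, 10]. [cite: MoonenZarhin1999LowDim, §3 (3.4) and (3.8)]
* [Gordon1999HodgeAVSurvey] B. B. Gordon, *A survey of the Hodge conjecture for abelian varieties*, §3 Theorem (Imai), 7.5, 7.6.1, 9.1.
  [cite: Gordon1999HodgeAVSurvey, §3 Theorem (Imai) and 7.6.1]
* [MumfordAV1970] D. Mumford, *Abelian Varieties* (1970), §19 Thm. 1, Cor. 2. [cite: MumfordAV1970, §19 Cor. 2 of Thm. 1]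
-/

noncomputable section

open CategoryTheory CategoryTheory.Limits Module
open scoped BigOperators

namespace Summit.HodgeConjecture.CorCM

open Literature.AlgebraicGeometry.Motives
open Literature.AlgebraicGeometry.Motives.AbelianVariety
open Literature.AlgebraicGeometry.Motives.HodgeStructure
open Literature.AlgebraicGeometry.HodgeTheory
open Literature.AlgebraicGeometry.ComplexMultiplication
open Literature.AlgebraicGeometry.Milne1999 (IsOfCMType isOfCMType_iff_of_isIsogenous hom_eq_zero_of_isSimple_of_not_isIsogenous)

variable [HodgeTensorFacts.{0, 0}] {X X' T : AbelianVariety ℂ} {n n' : ℕ} {m : ℕ} {E : Fin (m + 1) → AbelianVariety ℂ}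

/-! ## §1 Pairwise non-isogenous curves -/

/-- **`t(T × ⨁E) + 1 = t(T) + t(⨁E)` — `Hg(T × E₀ × ⋯ × E_m) = Hg(T) × Hg(E₀ × ⋯ × E_m)`** — for a simple abelian threefold `T` with
`T` of CM type and pairwise non-isogenous elliptic curves `E₀, …, E_m` (CM or not) such that NO CM curve among them has `End⁰E_j ↪ End⁰T`.
(Split by «CM»: the non-CM curves add `3` each on both sides, Lemma (3.4); the CM ones give `t(T × ⨁E_C) = 4 + #C` by b16ʼs criterion against
`t(⨁E_C) = #C + 1`.) [cite: MoonenZarhin1999LowDim, §3 (3.4), (3.6) and (3.8)] [cite: Gordon1999HodgeAVSurvey, §3 Theorem (Imai) and 7.6.1] -/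
theorem mtRank_hodge_one_add_one_eq_of_isIsogenous_cmThreefold_prod_biproduct_curves_of_isEmpty (hX : IsSmoothProjective n X.X)
    (hX' : IsSmoothProjective n' X'.X) (hTs : T.IsSimple) (hT3 : T.dim = 3) (hTcm : IsOfCMType T)
    (hE1 : ∀ j, (E j).dim = 1) (hniso : ∀ i j, i ≠ j → ¬ IsIsogenous (E i) (E j))
    (hfor : ∀ j, IsOfCMType (E j) → IsEmpty ((E j).endAlgebra →+* T.endAlgebra))
    (hXP : IsIsogenous X (T.prod (⨁ E))) (hX'E : IsIsogenous X' (⨁ E)) :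
    haveI := BettiUniverse.finite hX 1
    haveI := BettiUniverse.finite hX' 1
    (BettiUniverse.hodge exists_isReal_hodgeModel_holds hX 1).mtRank + 1 =
      4 + (BettiUniverse.hodge exists_isReal_hodgeModel_holds hX' 1).mtRank := by
  classical
  haveI := BettiUniverse.finite hX 1
  haveI := BettiUniverse.finite hX' 1
  have hT : IsSmoothProjective T.dim T.X := AbelianVariety.isSmoothProjective_holds
  haveI := BettiUniverse.finite hT 1
  have h4 : (BettiUniverse.hodge exists_isReal_hodgeModel_holds hT 1).mtRank = 4 := mtRank_hodge_one_eq_four_of_isSimple_cmThreefold hT hTs hT3 hTcm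
  have hTE0 : ∀ {C : AbelianVariety ℂ}, C.dim = 1 → ∀ u : T ⟶ C, u = 0 := fun hC1 u =>
    hom_eq_zero_of_isSimple_of_not_isIsogenous hTs (isSimple_of_dim_le_one hC1.le)
      (fun h => by have hd : T.dim = _ := dim_eq_of_isIsogenous_holds h; rw [hC1] at hd; omega) u
  by_cases hall : ∀ j, IsOfCMType (E j)
  · -- all CM: criterion `m + 5` against Kubota `m + 2`
    have h := mtRank_hodge_one_eq_of_isIsogenous_cmThreefold_prod_biproduct_cmCurves_of_forall_isEmpty hX hTs hT3 hTcm hE1 hall hniso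
      (fun j => hfor j (hall j)) hXP
    have h' := mtRank_hodge_one_eq_card_add_one_of_isIsogenous_biproduct_elliptic (C := Fin (m + 1)) hE1 hall hniso (cls := id)
      Function.surjective_id hX' hX'E
    rw [Fintype.card_fin] at h'
    omega
  by_cases hnone : ∀ j, ¬ IsOfCMType (E j)
  · -- no CM curve: `4 + 3(m+1)` against `3(m+1) + 1`
    have h := mtRank_hodge_one_eq_add_of_isIsogenous_prod_biproduct_nonCM_curves hX hT (by omega) hE1 hnone
      (fun j l hjl => hniso j l hjl) (fun j u => hTE0 (hE1 j) u) hXP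
    have h' := mtRank_hodge_one_eq_of_biproduct_nonCM_curves hX' hE1 hnone (fun j l hjl => hniso j l hjl) hX'E
    omega
  -- mixed: split by «CM»
  push Not at hall hnone
  obtain ⟨j₁, hj₁⟩ := hall
  obtain ⟨j₂, hj₂⟩ := hnone
  obtain ⟨mC, mN, EC, EN, hcard, hCE, hNE, -, hEC1, hEN1, hECcm, hENcm, hECniso, hENniso, hCN, hsplit⟩ :=
    exists_split_cm_nonCM_curves hE1 hniso hj₁ hj₂
  have hA : IsSmoothProjective (T.prod (⨁ EC)).dim (T.prod (⨁ EC)).X := AbelianVariety.isSmoothProjective_holds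
  haveI := BettiUniverse.finite hA 1
  have hXQ : IsIsogenous X ((T.prod (⨁ EC)).prod (⨁ EN)) :=
    (hXP.trans ((IsIsogenous.refl T).prod hsplit)).trans (Literature.AlgebraicGeometry.HodgeTheory.isIsogenous_prod_assoc T (⨁ EC) (⨁ EN)).symm'
  have hAE : ∀ j, ∀ u : T.prod (⨁ EC) ⟶ EN j, u = 0 := fun j =>
    hom_prod_eq_zero_of_forall_eq_zero (hTE0 (hEN1 j)) fun v => biproduct.hom_ext' _ _ fun i => by
      rw [comp_zero]
      exact hom_eq_zero_of_isSimple_of_not_isIsogenous (isSimple_of_dim_le_one (hEC1 i).le) (isSimple_of_dim_le_one (hEN1 j).le) (hCN i j) _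
  have hN := mtRank_hodge_one_eq_add_of_isIsogenous_prod_biproduct_nonCM_curves hX hA (by rw [dim_prod]; omega) hEN1 hENcm hENniso hAE hXQ
  have hforC : ∀ i, IsEmpty ((EC i).endAlgebra →+* T.endAlgebra) := fun i => by
    obtain ⟨j, hj⟩ := hCE i; rw [hj]; exact hfor j (hj ▸ hECcm i)
  have hC := mtRank_hodge_one_eq_of_isIsogenous_cmThreefold_prod_biproduct_cmCurves_of_forall_isEmpty hA hTs hT3 hTcm hEC1 hECcm hECniso hforC
    (IsIsogenous.refl _)
  have h' := mtRank_hodge_one_eq_of_biproduct_cm_curves_prod_biproduct_nonCM_curves hX' hEC1 hECcm hECniso hEN1 hENcm hENniso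
    (hX'E.trans hsplit)
  omega

/-- **`t(T × ⨁E) + 2 = t(T) + t(⨁E)`** for a simple abelian threefold `T` with `T` of CM type, pairwise non-isogenous elliptic curves
`E₀, …, E_m` (CM or not), and SOME CM curve `E_{j₀}` with `End⁰E_{j₀} ↪ End⁰T`: its torus `U(1)` is absorbed in the torus `Hg(T)`, every
other curve contributes as in the free case. [cite: MoonenZarhin1999LowDim, §3 (3.4), (3.6) and (3.8)]
[cite: Gordon1999HodgeAVSurvey, §3 Theorem (Imai) and 7.6.1] -/
theorem mtRank_hodge_one_add_two_eq_of_isIsogenous_cmThreefold_prod_biproduct_curves_of_nonempty (hX : IsSmoothProjective n X.X)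
    (hX' : IsSmoothProjective n' X'.X) (hTs : T.IsSimple) (hT3 : T.dim = 3) (hTcm : IsOfCMType T)
    (hE1 : ∀ j, (E j).dim = 1) (hniso : ∀ i j, i ≠ j → ¬ IsIsogenous (E i) (E j))
    {j₀ : Fin (m + 1)} (hj₀cm : IsOfCMType (E j₀)) (hj₀ : Nonempty ((E j₀).endAlgebra →+* T.endAlgebra))
    (hXP : IsIsogenous X (T.prod (⨁ E))) (hX'E : IsIsogenous X' (⨁ E)) :
    haveI := BettiUniverse.finite hX 1
    haveI := BettiUniverse.finite hX' 1
    (BettiUniverse.hodge exists_isReal_hodgeModel_holds hX 1).mtRank + 2 =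
      4 + (BettiUniverse.hodge exists_isReal_hodgeModel_holds hX' 1).mtRank := by
  classical
  haveI := BettiUniverse.finite hX 1
  haveI := BettiUniverse.finite hX' 1
  have hT : IsSmoothProjective T.dim T.X := AbelianVariety.isSmoothProjective_holds
  haveI := BettiUniverse.finite hT 1
  have hTE0 : ∀ {C : AbelianVariety ℂ}, C.dim = 1 → ∀ u : T ⟶ C, u = 0 := fun hC1 u =>
    hom_eq_zero_of_isSimple_of_not_isIsogenous hTs (isSimple_of_dim_le_one hC1.le)
      (fun h => by have hd : T.dim = _ := dim_eq_of_isIsogenous_holds h; rw [hC1] at hd; omega) u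
  by_cases hall : ∀ j, IsOfCMType (E j)
  · -- all CM: `m + 4` against Kubota `m + 2`
    have h := mtRank_hodge_one_eq_of_isIsogenous_cmThreefold_prod_biproduct_cmCurves_of_nonempty hX hTs hT3 hTcm hE1 hall hniso hj₀ hXP
    have h' := mtRank_hodge_one_eq_card_add_one_of_isIsogenous_biproduct_elliptic (C := Fin (m + 1)) hE1 hall hniso (cls := id)
      Function.surjective_id hX' hX'E
    rw [Fintype.card_fin] at h'
    omega
  -- mixed (the family contains the CM curve `E_{j₀}`): split by «CM»
  push Not at hall
  obtain ⟨j₁, hj₁⟩ := hall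
  obtain ⟨mC, mN, EC, EN, hcard, hCE, hNE, hCsurj, hEC1, hEN1, hECcm, hENcm, hECniso, hENniso, hCN, hsplit⟩ :=
    exists_split_cm_nonCM_curves hE1 hniso hj₁ hj₀cm
  have hA : IsSmoothProjective (T.prod (⨁ EC)).dim (T.prod (⨁ EC)).X := AbelianVariety.isSmoothProjective_holds
  haveI := BettiUniverse.finite hA 1
  have hXQ : IsIsogenous X ((T.prod (⨁ EC)).prod (⨁ EN)) :=
    (hXP.trans ((IsIsogenous.refl T).prod hsplit)).trans (Literature.AlgebraicGeometry.HodgeTheory.isIsogenous_prod_assoc T (⨁ EC) (⨁ EN)).symm'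
  have hAE : ∀ j, ∀ u : T.prod (⨁ EC) ⟶ EN j, u = 0 := fun j =>
    hom_prod_eq_zero_of_forall_eq_zero (hTE0 (hEN1 j)) fun v => biproduct.hom_ext' _ _ fun i => by
      rw [comp_zero]
      exact hom_eq_zero_of_isSimple_of_not_isIsogenous (isSimple_of_dim_le_one (hEC1 i).le) (isSimple_of_dim_le_one (hEN1 j).le) (hCN i j) _
  have hN := mtRank_hodge_one_eq_add_of_isIsogenous_prod_biproduct_nonCM_curves hX hA (by rw [dim_prod]; omega) hEN1 hENcm hENniso hAE hXQ
  -- the CM part contains `E_{j₀}`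
  obtain ⟨i₀, hi₀⟩ := hCsurj j₀ hj₀cm
  have hi₀' : Nonempty ((EC i₀).endAlgebra →+* T.endAlgebra) := by rw [hi₀]; exact hj₀
  have hC := mtRank_hodge_one_eq_of_isIsogenous_cmThreefold_prod_biproduct_cmCurves_of_nonempty hA hTs hT3 hTcm hEC1 hECcm hECniso hi₀'
    (IsIsogenous.refl _)
  have h' := mtRank_hodge_one_eq_of_biproduct_cm_curves_prod_biproduct_nonCM_curves hX' hEC1 hECcm hECniso hEN1 hENcm hENniso
    (hX'E.trans hsplit)
  omega



/-- **`t(T × E₀ × ⋯ × E_m) = 3a + b + 10`** (`a` non-CM curves, `b` CM curves, pairwise non-isogenous, no CM field inside `End⁰T`), in the tree's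
packaging of `a`, `b` (`t(⨁E) = 3a + b + 1`, `CorCM/MumfordTateRankProductsOfCurves`). [cite: MoonenZarhin1999LowDim, §3 (3.4), (3.6) and (3.8)] -/
theorem exists_mtRank_hodge_one_eq_of_isIsogenous_cmThreefold_prod_biproduct_curves_of_isEmpty (hX : IsSmoothProjective n X.X)
    (hTs : T.IsSimple) (hT3 : T.dim = 3) (hTcm : IsOfCMType T)
    (hE1 : ∀ j, (E j).dim = 1) (hniso : ∀ i j, i ≠ j → ¬ IsIsogenous (E i) (E j))
    (hfor : ∀ j, IsOfCMType (E j) → IsEmpty ((E j).endAlgebra →+* T.endAlgebra)) (hXP : IsIsogenous X (T.prod (⨁ E))) :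
    haveI := BettiUniverse.finite hX 1
    ∃ a b : ℕ, 1 ≤ a + b ∧ a + b ≤ m + 1 ∧ (BettiUniverse.hodge exists_isReal_hodgeModel_holds hX 1).mtRank = 3 * a + b + 4 ∧
      (a = 0 ↔ ∀ j, IsOfCMType (E j)) ∧ (b = 0 ↔ ∀ j, ¬ IsOfCMType (E j)) := by
  haveI := BettiUniverse.finite hX 1
  have hY : IsSmoothProjective (⨁ E).dim (⨁ E).X := AbelianVariety.isSmoothProjective_holds
  haveI := BettiUniverse.finite hY 1
  have h := mtRank_hodge_one_add_one_eq_of_isIsogenous_cmThreefold_prod_biproduct_curves_of_isEmpty hX hY hTs hT3 hTcm hE1 hniso hfor hXP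
    (IsIsogenous.refl _)
  obtain ⟨a, b, h1, hm, ht, ha, hb⟩ := exists_mtRank_hodge_one_eq_of_biproduct_curves hY hE1 (IsIsogenous.refl _)
  exact ⟨a, b, h1, hm, by omega, ha, hb⟩

/-- **`t(T × E₀ × ⋯ × E_m) = 3a + b + 9`** (`a` non-CM curves, `b ≥ 1` CM curves, pairwise non-isogenous, SOME CM field inside `End⁰T`).
[cite: MoonenZarhin1999LowDim, §3 (3.4), (3.6) and (3.8)] -/
theorem exists_mtRank_hodge_one_eq_of_isIsogenous_cmThreefold_prod_biproduct_curves_of_nonempty (hX : IsSmoothProjective n X.X)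
    (hTs : T.IsSimple) (hT3 : T.dim = 3) (hTcm : IsOfCMType T)
    (hE1 : ∀ j, (E j).dim = 1) (hniso : ∀ i j, i ≠ j → ¬ IsIsogenous (E i) (E j))
    {j₀ : Fin (m + 1)} (hj₀cm : IsOfCMType (E j₀)) (hj₀ : Nonempty ((E j₀).endAlgebra →+* T.endAlgebra)) (hXP : IsIsogenous X (T.prod (⨁ E))) :
    haveI := BettiUniverse.finite hX 1
    ∃ a b : ℕ, 1 ≤ b ∧ a + b ≤ m + 1 ∧ (BettiUniverse.hodge exists_isReal_hodgeModel_holds hX 1).mtRank = 3 * a + b + 3 ∧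
      (a = 0 ↔ ∀ j, IsOfCMType (E j)) := by
  haveI := BettiUniverse.finite hX 1
  have hY : IsSmoothProjective (⨁ E).dim (⨁ E).X := AbelianVariety.isSmoothProjective_holds
  haveI := BettiUniverse.finite hY 1
  have h := mtRank_hodge_one_add_two_eq_of_isIsogenous_cmThreefold_prod_biproduct_curves_of_nonempty hX hY hTs hT3 hTcm hE1 hniso hj₀cm hj₀
    hXP (IsIsogenous.refl _)
  obtain ⟨a, b, h1, hm, ht, ha, hb⟩ := exists_mtRank_hodge_one_eq_of_biproduct_curves hY hE1 (IsIsogenous.refl _)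
  have hb1 : 1 ≤ b := by
    rcases Nat.eq_zero_or_pos b with hb0 | hb0
    · exact absurd hj₀cm (hb.1 hb0 j₀)
    · exact hb0
  exact ⟨a, b, hb1, hm, by omega, ha⟩
/-! ## §2 Any elliptic curves (repetitions allowed) -/

/-- **`t(T × E₀ × ⋯ × E_m) + 1 = t(T) + t(E₀ × ⋯ × E_m)` — `Hg(T × ⨁E) = Hg(T) × Hg(⨁E)` — for a simple abelian threefold `T` with `T` of CM type
and ANY elliptic curves `E₀, …, E_m` (repetitions, CM of any field, non-CM) such that no CM curve among them has `End⁰E_j ↪ End⁰T`.**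
[cite: MoonenZarhin1999LowDim, §3 (3.4), (3.6) and (3.8)] [cite: Gordon1999HodgeAVSurvey, §3 Theorem (Imai) and 7.6.1] -/
theorem mtRank_hodge_one_add_one_eq_of_isIsogenous_cmThreefold_prod_biproduct_anyCurves_of_isEmpty (hX : IsSmoothProjective n X.X)
    (hX' : IsSmoothProjective n' X'.X) (hTs : T.IsSimple) (hT3 : T.dim = 3) (hTcm : IsOfCMType T)
    (hE1 : ∀ j, (E j).dim = 1) (hfor : ∀ j, IsOfCMType (E j) → IsEmpty ((E j).endAlgebra →+* T.endAlgebra))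
    (hXP : IsIsogenous X (T.prod (⨁ E))) (hX'E : IsIsogenous X' (⨁ E)) :
    haveI := BettiUniverse.finite hX 1
    haveI := BettiUniverse.finite hX' 1
    (BettiUniverse.hodge exists_isReal_hodgeModel_holds hX 1).mtRank + 1 =
      4 + (BettiUniverse.hodge exists_isReal_hodgeModel_holds hX' 1).mtRank := by
  haveI := BettiUniverse.finite hX 1
  haveI := BettiUniverse.finite hX' 1
  obtain ⟨m', R, hRE, -, hRniso, hbase, hfree⟩ := exists_representatives_mtRank_eq_of_curves hE1
  have hY : IsSmoothProjective (T.prod (⨁ R)).dim (T.prod (⨁ R)).X := AbelianVariety.isSmoothProjective_holds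
  have hY' : IsSmoothProjective (⨁ R).dim (⨁ R).X := AbelianVariety.isSmoothProjective_holds
  haveI := BettiUniverse.finite hY 1
  haveI := BettiUniverse.finite hY' 1
  have hR1 : ∀ i, (R i).dim = 1 := fun i => by obtain ⟨j, hj⟩ := hRE i; rw [hj, hE1]
  have hRfor : ∀ i, IsOfCMType (R i) → IsEmpty ((R i).endAlgebra →+* T.endAlgebra) := fun i => by
    obtain ⟨j, hj⟩ := hRE i; rw [hj]; exact hfor j
  have h := mtRank_hodge_one_add_one_eq_of_isIsogenous_cmThreefold_prod_biproduct_curves_of_isEmpty hY hY' hTs hT3 hTcm hR1 hRniso hRfor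
    (IsIsogenous.refl _) (IsIsogenous.refl _)
  rw [hbase hX hY (by omega) hXP (IsIsogenous.refl _), hfree hX' hY' hX'E (IsIsogenous.refl _)]
  exact h

/-- **`t(T × E₀ × ⋯ × E_m) + 2 = t(T) + t(E₀ × ⋯ × E_m)`** for a simple abelian threefold `T` with `T` of CM type, ANY elliptic curves
`E₀, …, E_m`, and SOME CM curve `E_{j₀}` with `End⁰E_{j₀} ↪ End⁰T` (its `U(1)` is absorbed in the torus `Hg(T)`; the condition passes to the representative of
its isogeny class, `End⁰` and CM type being isogeny invariants). [cite: MoonenZarhin1999LowDim, §3 (3.4), (3.6) and (3.8)]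
[cite: MumfordAV1970, §19 Cor. 2 of Thm. 1] -/
theorem mtRank_hodge_one_add_two_eq_of_isIsogenous_cmThreefold_prod_biproduct_anyCurves_of_nonempty (hX : IsSmoothProjective n X.X)
    (hX' : IsSmoothProjective n' X'.X) (hTs : T.IsSimple) (hT3 : T.dim = 3) (hTcm : IsOfCMType T)
    (hE1 : ∀ j, (E j).dim = 1) {j₀ : Fin (m + 1)} (hj₀cm : IsOfCMType (E j₀)) (hj₀ : Nonempty ((E j₀).endAlgebra →+* T.endAlgebra))
    (hXP : IsIsogenous X (T.prod (⨁ E))) (hX'E : IsIsogenous X' (⨁ E)) :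
    haveI := BettiUniverse.finite hX 1
    haveI := BettiUniverse.finite hX' 1
    (BettiUniverse.hodge exists_isReal_hodgeModel_holds hX 1).mtRank + 2 =
      4 + (BettiUniverse.hodge exists_isReal_hodgeModel_holds hX' 1).mtRank := by
  haveI := BettiUniverse.finite hX 1
  haveI := BettiUniverse.finite hX' 1
  obtain ⟨m', R, hRE, hER, hRniso, hbase, hfree⟩ := exists_representatives_mtRank_eq_of_curves hE1
  have hY : IsSmoothProjective (T.prod (⨁ R)).dim (T.prod (⨁ R)).X := AbelianVariety.isSmoothProjective_holds
  have hY' : IsSmoothProjective (⨁ R).dim (⨁ R).X := AbelianVariety.isSmoothProjective_holds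
  haveI := BettiUniverse.finite hY 1
  haveI := BettiUniverse.finite hY' 1
  have hR1 : ∀ i, (R i).dim = 1 := fun i => by obtain ⟨j, hj⟩ := hRE i; rw [hj, hE1]
  -- the representative of the class of `E_{j₀}` is CM with field inside `End⁰T`
  obtain ⟨i₀, hi₀⟩ := hER j₀
  have hi₀cm : IsOfCMType (R i₀) := (isOfCMType_iff_of_isIsogenous hi₀).1 hj₀cm
  have hi₀for : Nonempty ((R i₀).endAlgebra →+* T.endAlgebra) := by
    obtain ⟨e⟩ := hi₀.symm'.nonempty_endAlgebra_algEquiv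
    obtain ⟨f⟩ := hj₀
    exact ⟨f.comp e.toRingEquiv.toRingHom⟩
  have h := mtRank_hodge_one_add_two_eq_of_isIsogenous_cmThreefold_prod_biproduct_curves_of_nonempty hY hY' hTs hT3 hTcm hR1 hRniso hi₀cm
    hi₀for (IsIsogenous.refl _) (IsIsogenous.refl _)
  rw [hbase hX hY (by omega) hXP (IsIsogenous.refl _), hfree hX' hY' hX'E (IsIsogenous.refl _)]
  exact h



/-- **`t(T × E₀ × ⋯ × E_m) = 3a + b + 10`** for ANY elliptic curves none of whose CM fields lies in `End⁰T` — `a`, `b` the numbers of isogeny classes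
of non-CM / CM curves among them (`Hg` = a torus of rank `3 + b` times `SL₂^a`). [cite: MoonenZarhin1999LowDim, §3 (3.4), (3.6) and (3.8)]
[cite: Gordon1999HodgeAVSurvey, §3 Theorem (Imai) and 7.6.1] -/
theorem exists_mtRank_hodge_one_eq_of_isIsogenous_cmThreefold_prod_biproduct_anyCurves_of_isEmpty (hX : IsSmoothProjective n X.X)
    (hTs : T.IsSimple) (hT3 : T.dim = 3) (hTcm : IsOfCMType T) (hE1 : ∀ j, (E j).dim = 1)
    (hfor : ∀ j, IsOfCMType (E j) → IsEmpty ((E j).endAlgebra →+* T.endAlgebra)) (hXP : IsIsogenous X (T.prod (⨁ E))) :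
    haveI := BettiUniverse.finite hX 1
    ∃ a b : ℕ, 1 ≤ a + b ∧ a + b ≤ m + 1 ∧ (BettiUniverse.hodge exists_isReal_hodgeModel_holds hX 1).mtRank = 3 * a + b + 4 ∧
      (a = 0 ↔ ∀ j, IsOfCMType (E j)) ∧ (b = 0 ↔ ∀ j, ¬ IsOfCMType (E j)) := by
  haveI := BettiUniverse.finite hX 1
  have hY : IsSmoothProjective (⨁ E).dim (⨁ E).X := AbelianVariety.isSmoothProjective_holds
  haveI := BettiUniverse.finite hY 1
  have h := mtRank_hodge_one_add_one_eq_of_isIsogenous_cmThreefold_prod_biproduct_anyCurves_of_isEmpty hX hY hTs hT3 hTcm hE1 hfor hXP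
    (IsIsogenous.refl _)
  obtain ⟨a, b, h1, hm, ht, ha, hb⟩ := exists_mtRank_hodge_one_eq_of_biproduct_curves hY hE1 (IsIsogenous.refl _)
  exact ⟨a, b, h1, hm, by omega, ha, hb⟩

/-- **`t(T × E₀ × ⋯ × E_m) = 3a + b + 9`** for ANY elliptic curves among which SOME CM curve has its field inside `End⁰T` — `a`, `b ≥ 1` the numbers
of isogeny classes of non-CM / CM curves (torus of rank `3 + b − 1` times `SL₂^a`). [cite: MoonenZarhin1999LowDim, §3 (3.4), (3.6) and (3.8)] -/
theorem exists_mtRank_hodge_one_eq_of_isIsogenous_cmThreefold_prod_biproduct_anyCurves_of_nonempty (hX : IsSmoothProjective n X.X)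
    (hTs : T.IsSimple) (hT3 : T.dim = 3) (hTcm : IsOfCMType T) (hE1 : ∀ j, (E j).dim = 1)
    {j₀ : Fin (m + 1)} (hj₀cm : IsOfCMType (E j₀)) (hj₀ : Nonempty ((E j₀).endAlgebra →+* T.endAlgebra)) (hXP : IsIsogenous X (T.prod (⨁ E))) :
    haveI := BettiUniverse.finite hX 1
    ∃ a b : ℕ, 1 ≤ b ∧ a + b ≤ m + 1 ∧ (BettiUniverse.hodge exists_isReal_hodgeModel_holds hX 1).mtRank = 3 * a + b + 3 ∧
      (a = 0 ↔ ∀ j, IsOfCMType (E j)) := by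
  haveI := BettiUniverse.finite hX 1
  have hY : IsSmoothProjective (⨁ E).dim (⨁ E).X := AbelianVariety.isSmoothProjective_holds
  haveI := BettiUniverse.finite hY 1
  have h := mtRank_hodge_one_add_two_eq_of_isIsogenous_cmThreefold_prod_biproduct_anyCurves_of_nonempty hX hY hTs hT3 hTcm hE1 hj₀cm hj₀
    hXP (IsIsogenous.refl _)
  obtain ⟨a, b, h1, hm, ht, ha, hb⟩ := exists_mtRank_hodge_one_eq_of_biproduct_curves hY hE1 (IsIsogenous.refl _)
  have hb1 : 1 ≤ b := by
    rcases Nat.eq_zero_or_pos b with hb0 | hb0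
    · exact absurd hj₀cm (hb.1 hb0 j₀)
    · exact hb0
  exact ⟨a, b, hb1, hm, by omega, ha⟩


/-! ## §3 Every simple abelian threefold times any elliptic curves -/

/-- **`t(T × E₀ × ⋯ × E_m) + 1 = t(T) + t(E₀ × ⋯ × E_m)` for EVERY simple abelian threefold `T` and ANY elliptic curves `E_j`, provided no CM curve among
them has `End⁰E_j ↪ End⁰T`** (`Hg(T × ⨁E) = Hg(T) × Hg(⨁E)`): `End⁰T = ℚ` (`t(T) = 22`, `CorCM/MumfordTateRankTimesLowGeneric`), a totally real cubic field
(`10`, `…TimesRealMultiplicationCells`), an imaginary quadratic field (`10`, `CorCM/MumfordTateRankTypeIVThreefoldTimesAllCurves`), or a CM field (`4`, §2).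
[cite: MoonenZarhin1999LowDim, §2 (2.3), §3 (3.4), (3.8) and §5 (5.2)] [cite: Gordon1999HodgeAVSurvey, §3 Theorem (Imai) and 7.6.1] -/
theorem mtRank_hodge_one_add_one_eq_of_isIsogenous_isSimple_threefold_prod_biproduct_anyCurves_of_isEmpty {k : ℕ} (hX : IsSmoothProjective n X.X)
    (hX' : IsSmoothProjective n' X'.X) (hT : IsSmoothProjective k T.X) (hTs : T.IsSimple) (hT3 : T.dim = 3) (hE1 : ∀ j, (E j).dim = 1)
    (hfor : ∀ j, IsOfCMType (E j) → IsEmpty ((E j).endAlgebra →+* T.endAlgebra)) (hXP : IsIsogenous X (T.prod (⨁ E))) (hX'E : IsIsogenous X' (⨁ E)) :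
    haveI := BettiUniverse.finite hX 1
    haveI := BettiUniverse.finite hX' 1
    haveI := BettiUniverse.finite hT 1
    (BettiUniverse.hodge exists_isReal_hodgeModel_holds hX 1).mtRank + 1 =
      (BettiUniverse.hodge exists_isReal_hodgeModel_holds hT 1).mtRank + (BettiUniverse.hodge exists_isReal_hodgeModel_holds hX' 1).mtRank := by
  classical
  haveI := BettiUniverse.finite hX 1
  haveI := BettiUniverse.finite hX' 1
  haveI := BettiUniverse.finite hT 1
  have hP : IsSmoothProjective (⨁ E).dim (⨁ E).X := AbelianVariety.isSmoothProjective_holds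
  haveI := BettiUniverse.finite hP 1
  have hP0 : 0 < (⨁ E).dim := by
    rw [AndreRiemann.dim_biproduct_fin]
    exact Finset.sum_pos (fun j _ => by rw [hE1]; exact one_pos) Finset.univ_nonempty
  have hPT : ∀ u : (⨁ E) ⟶ T, u = 0 := fun u => biproduct.hom_ext' _ _ fun j => by
    rw [comp_zero]
    exact hom_eq_zero_of_isSimple_of_not_isIsogenous (isSimple_of_dim_le_one (hE1 j).le) hTs
      (fun h => by have hd : (E j).dim = T.dim := dim_eq_of_isIsogenous_holds h; rw [hE1] at hd; omega) _
  have hXP' : IsIsogenous X ((⨁ E).prod T) := hXP.trans (isIsogenous_prod_comm T (⨁ E))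
  have hPX' := Literature.AlgebraicGeometry.Pohlmann1968.mtRank_hodge_one_eq_of_isIsogenous hX' hP hX'E
  rcases mtRank_hodge_one_of_isSimple_threefold hT hTs hT3 with ⟨h1, h22⟩ | ⟨h2, h10⟩ | ⟨h3, h10⟩ | ⟨-, hcm, h4⟩
  · have h := mtRank_hodge_one_eq_add_of_isIsogenous_prod_threefold_endRankOne hX hP hP0 hT3 h1 hPT hXP'
    omega
  · have h := mtRank_hodge_one_add_one_eq_of_isIsogenous_typeIV_threefold_prod_biproduct_anyCurves_of_isEmpty hX hX' hTs hT3 h2 hE1 hfor hXP hX'E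
    omega
  · have h := mtRank_hodge_one_eq_add_nine_of_isIsogenous_prod_threefold_of_finrank_endAlgebra_eq_three hX hP hP0 hTs hT3 h3 hPT hXP'
    omega
  · have h := mtRank_hodge_one_add_one_eq_of_isIsogenous_cmThreefold_prod_biproduct_anyCurves_of_isEmpty hX hX' hTs hT3 hcm hE1 hfor hXP hX'E
    omega

/-- **`t(T × E₀ × ⋯ × E_m) + 2 = t(T) + t(E₀ × ⋯ × E_m)` for a simple abelian threefold `T` with `dim_ℚ End⁰T ∈ {2, 6}`** (imaginary quadratic or CM
field) and ANY elliptic curves among which SOME CM curve has `End⁰E_{j₀} ↪ End⁰T`: that curve's torus is absorbed in the centre of `Hg(T)`.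
[cite: MoonenZarhin1999LowDim, Thm. (0.2), §3 (3.4) and (3.8)] -/
theorem mtRank_hodge_one_add_two_eq_of_isIsogenous_isSimple_threefold_prod_biproduct_anyCurves_of_nonempty {k : ℕ} (hX : IsSmoothProjective n X.X)
    (hX' : IsSmoothProjective n' X'.X) (hT : IsSmoothProjective k T.X) (hTs : T.IsSimple) (hT3 : T.dim = 3)
    (hTE : Module.finrank ℚ T.endAlgebra = 2 ∨ Module.finrank ℚ T.endAlgebra = 6) (hE1 : ∀ j, (E j).dim = 1)
    {j₀ : Fin (m + 1)} (hj₀cm : IsOfCMType (E j₀)) (hj₀ : Nonempty ((E j₀).endAlgebra →+* T.endAlgebra))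
    (hXP : IsIsogenous X (T.prod (⨁ E))) (hX'E : IsIsogenous X' (⨁ E)) :
    haveI := BettiUniverse.finite hX 1
    haveI := BettiUniverse.finite hX' 1
    haveI := BettiUniverse.finite hT 1
    (BettiUniverse.hodge exists_isReal_hodgeModel_holds hX 1).mtRank + 2 =
      (BettiUniverse.hodge exists_isReal_hodgeModel_holds hT 1).mtRank + (BettiUniverse.hodge exists_isReal_hodgeModel_holds hX' 1).mtRank := by
  haveI := BettiUniverse.finite hX 1
  haveI := BettiUniverse.finite hX' 1
  haveI := BettiUniverse.finite hT 1
  rcases hTE with h2 | h6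
  · have h10 : (BettiUniverse.hodge exists_isReal_hodgeModel_holds hT 1).mtRank = 10 :=
      (mtRank_hodge_one_of_isSimple_threefold_of_finrank_endAlgebra_eq_two hT hTs hT3 h2).1
    have h := mtRank_hodge_one_add_two_eq_of_isIsogenous_typeIV_threefold_prod_biproduct_anyCurves_of_nonempty hX hX' hTs hT3 h2 hE1 hj₀cm hj₀
      hXP hX'E
    omega
  · have hcm := isOfCMType_of_isSimple_threefold_of_finrank_endAlgebra_eq_six hTs hT3 h6
    have h4 := mtRank_hodge_one_eq_four_of_isSimple_cmThreefold hT hTs hT3 hcm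
    have h := mtRank_hodge_one_add_two_eq_of_isIsogenous_cmThreefold_prod_biproduct_anyCurves_of_nonempty hX hX' hTs hT3 hcm hE1 hj₀cm hj₀
      hXP hX'E
    omega

end Summit.HodgeConjecture.CorCM

end
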